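import Summits.QuantumFields.BalabanUV.Beta.GAN24.CombSlavedDivRowsOfWardLetters
import Summits.QuantumFields.BalabanUV.Beta.GAN24.CombBlockCommutatorStepLetterDrift
import Summits.QuantumFields.BalabanUV.Beta.GAN24.CombT2RecSourceRows

/-!
# `BalabanUV.Beta.GAN24.CombSlavedDivRowsAtRecord` — binder row G-an2-4 ∕ (CONV-C), TRANSFER-III (the (α-0) chain at row D1's literal of record (III′)), links L8b ∕ L11:
# **THE SLAVED SLOT-DIVERGENCE ROWS OF THE EVEN COMB-CHART MEMBERS AND OF THEIR DRIFTS AT an1's RECORD `symTablesAn1S2 3 Lc cΛt` — W4's `Hh₁ Hh₂ Hh₁d Hh₂d` AT `ε = 1` —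
# FROM THE TABLE LAWS, THE SOURCE ROWS, THE S-SLOT ROWS OF `ScombOf` AND TWO SCALAR ROWS, THE S-STEP LETTER ROWS GONE** — MY `CombSlavedDivRowsOfWardLetters` (the (III′) twin
# of leaf-03 g69's FILE 4) with `hE ∕ hEd` discharged by MY slot twins of road-P2 g45's S-step letter sockets `CombBlockCommutatorStepLetter{,Drift}` (the K-slot hypothesis-free
# by leaf-02 g77's `KSlotCombChart`, «S′ from S» by leaf-02 g79's `CombSpureRowsOfSRows`), the record's border blocks by `rfl`; the (III′) analogue of the (E) step
# «FILE 4 ⨾ `BlockCommutatorStepLetter{,Drift}` §3» inside leaf-03 g69's `SlavedDivRowsOfWardLetters` — there the S-slot rows were the OWNER g22's chart-(II) END, here they are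
# the S′-campaign's rows and stay DISPLAYED (G-an2-4 CRUX TEAM (2), leaf prover `b2b-balaban-gan24-formalise-leaf-01`, gen 82 — crew GAN's kept leaf prover; no existing file
# touched)

NOT IN PRINT; OUR BOOKKEEPING ([folklore] three-line composition BY NAME — the junction probe `g82/cert/PROBE-F23-into-F1` of the journal INTENT-3 made a theorem at the
record; 0 `def`, 0 cited facts, 0 `def … : Prop`, 0 sorry).  HONEST FRAMING (cell contract, verbatim): «discharging `BetaPertH` makes Bałaban's UV stability UNCONDITIONAL
— a real constructive-QFT result; it is NOT the continuum limit and NOT the Clay problem.»  HONEST DEPENDENCY (verbatim): «continuum YM on T⁴ ⇐ BetaPertH ∧ nine spine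
estimates (0/9 proved); BetaPertH ⇐ (D1) ∧ (D4) ∧ CAP+tail; G-an2-4 gates asym, D1 and NE2/3/4.»

WHAT (`d = 3`, `2 ≤ Lc`, the record `symTablesAn1S2 3 Lc cΛt`, every `cE cVH cΛ cE₂ cB Tc`, generator scale `ξ`, in-block root `ρ = toSite r`; `T̃′♮_n`, `y′_n := ½ • (T̃′♮_n + P T̃′♮_n)`
the EVEN member, `G′♮_n := unitK_n (GcombSh Lc n)`, `S̃′_l := SpureCombOf (symTablesAn1S2 3 Lc cΛt) cE cVH cΛ l`):
**`exists_slavedDivRows_evenMember_comb_three_of_tableLaws`** — `∃ δ₃ σ₁ σ₂ σ₁d σ₂d ν₃, 0 < δ₃ ∧ 0 ≤ ν₃ < 1 ∧ Hh₁ ∧ Hh₂ ∧ Hh₁d ∧ Hh₂d` (W4's four binders at `ε = 1`, the record's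
tables) from EXACTLY: (a) per level the table laws `hTL ∕ hTL''` of `T̃′_l` in the shape `cH_l • Σ_{v∈box} divV (T̃′_l) (Lc•Y+v) = [S̃′_l, X_Y] + R_l Y`, `X_Y = diagK (ξ • Σ legInd ρ
(Lc•Y+v))`, with parities `hC` (commutator word EVEN), `hR hR''` (residual words ODD) — at (III′) an2's slot-generic laws at `G := GcombSh Lc` (the OWNER's
`CombEvenTowerAutonomy.trK_SpureCombOf` gives the first-order table's parity; the PIN twin is NOT typed here); (b) road-P2's source rows `Hb ∕ Hbd` in W4's spelling; (c) the
S-slot rows (hS, hSall) of `unitS_j (ScombOf (symTablesAn1S2 3 Lc cΛt) cE cVH cΛ j)`; (d) the scalar rows `hcH : |(sf_l·sm_l)⁻¹·(cH l)⁻¹| ≤ c₀`, `hq` (the product is `l`-free).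
§2 **`exists_slavedDivRows_evenMember_comb_three_of_tableLaws_sRows`** — the same with (b) `Hb ∕ Hbd` DISCHARGED by MY `CombT2RecSourceRows.exists_sourceRows_comb_three_an1_of_scombOf_rows`
(the source rows ⟸ the S-slot rows (hS, hSall) of `ScombOf` alone): W4's `Hh₁…Hh₂d` at the record ⟸ (a) table laws + parities, (c) the S-slot rows, (d) `hcH ∕ hq` — NOTHING ELSE.
WHAT THIS IS NOT.  Rows (a)–(d) are DISPLAYED; asserts NO value of any charge and NO shape of Bałaban's tables beyond them; NOTHING of (Q-L) ∕ (C) ∕ (C)sym ∕ `hcell ∕ hcelld` ∕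
one S-∕W-slot row discharged; the (III′) campaign is NOT asked (an2 W-4 l.64553) — zero weight; NEVER «G-an2-4 closed» as (CONV-C); NOT D1, NOT `BetaPertH`, NOT continuum,
NOT Clay; not in print.  2026-08-25.
-/

noncomputable section

open Finset
open scoped BigOperators
open Literature.MathematicalPhysics.QuantumFieldTheory
open Literature.MathematicalPhysics.QuantumFieldTheory.Balaban1983to89
open Literature.MathematicalPhysics.QuantumFieldTheory.Balaban1983to89.Beta
open ExpKernelCalculus (MKer comp)
open OneStepResolventKernel (Fib LocStencil)
open SecondOrderResponse (W2SymOfK)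
open BalabanStepJetsSucc (mmRead)
open BalabanStepW2 (K3OfK M2Of)
open KernelWard (divV)
open AffineAveraging (box toSite)
open BalabanCompositeJets (LocStencil₂)
open Summit.QuantumFields.BalabanUV.Beta.TameKernelCalculus (trK)
open Summit.QuantumFields.BalabanUV.Beta.BorderedHessian (sgnK diagK)
open Summit.QuantumFields.BalabanUV.Beta.AveragingWardRootedStencils (legInd)
open Summit.QuantumFields.BalabanUV.Beta.HessKerDressedUnits (unitK unitS)
open Summit.QuantumFields.BalabanUV.Beta.SecondOrderUnits (unitM unitS₂ unitM₂)
open Summit.QuantumFields.BalabanUV.Beta.SpineRooted (T2RecOf e3OfK)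
open Summit.QuantumFields.BalabanUV.Beta.CombChartStepJets (GcombSh ScombOf SpureCombOf)
open Summit.QuantumFields.BalabanUV.Beta.SymSecondOrderTablesAn1 (symTablesAn1S2)
open Summit.QuantumFields.BalabanUV.Beta.GAN24.CombesThomas (sfStep smStep)
open Summit.QuantumFields.BalabanUV.Beta.GAN24.CombSlavedDivRowsOfWardLetters (exists_slavedDivRows_halfMember_comb_of_wardLetters)
open Summit.QuantumFields.BalabanUV.Beta.GAN24.CombBlockCommutatorStepLetter (exists_comb_evenRows_uniform_three)
open Summit.QuantumFields.BalabanUV.Beta.GAN24.CombBlockCommutatorStepLetterDrift (exists_comb_evenRowsDrift_uniform_three)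
open Summit.QuantumFields.BalabanUV.Beta.GAN24.CombT2RecSourceRows (exists_sourceRows_comb_three_an1_of_scombOf_rows)

namespace Summit.QuantumFields.BalabanUV.Beta.GAN24.CombSlavedDivRowsAtRecord

variable {Lc : ℕ} [NeZero Lc]

/-! ## §1 W4's `Hh`-rows at the record from the table laws, the source rows, the S-slot rows and two scalar rows -/

/-- NOT IN PRINT; OUR BOOKKEEPING.  **THE SLAVED SLOT-DIVERGENCE ROWS OF THE EVEN COMB-CHART MEMBERS AT an1's RECORD — W4's `Hh₁ Hh₂ Hh₁d Hh₂d` (`ε = 1`, `d = 3`,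
`tabs := symTablesAn1S2 3 Lc cΛt`) FROM THE TABLE LAWS, THE SOURCE ROWS, THE S-SLOT ROWS OF `ScombOf` AND TWO SCALAR ROWS** (`2 ≤ Lc`, every `cΛt cE cVH cΛ cE₂ cB Tc`, any
generator scale `ξ`, any in-block root `r`, any residual words `R l ∕ R″ l`, any lock constants `cH l ≠ 0`): MY `CombSlavedDivRowsOfWardLetters` with its S-step letter rows
`hE ∕ hEd` DISCHARGED by MY `CombBlockCommutatorStepLetter.exists_comb_evenRows_uniform_three` ∕ `CombBlockCommutatorStepLetterDrift.exists_comb_evenRowsDrift_uniform_three`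
(K-slot hypothesis-free by leaf-02's `kSlotCombChart`; «S′ from S» by leaf-02's `CombSpureRowsOfSRows`) and the record's border blocks `hBff ∕ hBmm` by `rfl`
(`symVh₂SAn1_inl_inl ∕ _inr_inr`).  DISPLAYED: (a) the per-level table laws `hTL ∕ hTL''` of `T̃′_l` against `S̃′_l := SpureCombOf (symTablesAn1S2 3 Lc cΛt) cE cVH cΛ l` and
`X_Y := diagK (ξ • Σ_{v∈box} legInd ρ (Lc•Y+v))` with residual words `R l ∕ R″ l` (an2's slot-generic `WardLocusQuarticTableSlot.tableLaw_T2RecOf_succ ∕ _zero` shape) and the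
parities `hC hR hR''`; (b) the source rows `Hb ∕ Hbd` (W4's spelling; road-P2's (III′) socket); (c) the S-slot rows (hS, hSall) of `unitS_j (ScombOf …)` (the S′-campaign's);
(d) the scalar rows `hcH ∕ hq`.  Asserts NO value of any charge; discharges NO slot ∕ source ∕ cell row; NEVER «G-an2-4 closed» as (CONV-C). -/
theorem exists_slavedDivRows_evenMember_comb_three_of_tableLaws (hLc : 2 ≤ Lc) (cΛt cE cVH cΛ cE₂ cB ξ : ℝ) (Tc : Fin 4 → Fin 4 → Fin 4 → Fin 4 → ℝ)
    {r : Fin (3 + 1) → ℕ} (hr : r ∈ box (3 + 1) Lc)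
    {R R'' : ℕ → (Fin (3 + 1) → ℤ) → Fin (3 + 1) → (Fin (3 + 1) → ℤ) → MKer (3 + 1) (Fib 3)} {cH : ℕ → ℝ} (hcH0 : ∀ l, cH l ≠ 0)
    {c₀ : ℝ} (hcH : ∀ l, |(sfStep Lc l * smStep 3 Lc l)⁻¹ * (cH l)⁻¹| ≤ c₀)
    (hq : ∀ l, (sfStep Lc (l + 1) * smStep 3 Lc (l + 1))⁻¹ * (cH (l + 1))⁻¹ = (sfStep Lc l * smStep 3 Lc l)⁻¹ * (cH l)⁻¹)
    (hTL : ∀ (l : ℕ) (Y : Fin (3 + 1) → ℤ) (κ' : Fin (3 + 1)) (u' : Fin (3 + 1) → ℤ),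
      cH l • ∑ v ∈ box (3 + 1) Lc, divV (fun κ u => T2RecOf 3 Lc (GcombSh Lc) (SpureCombOf (symTablesAn1S2 3 Lc cΛt) cE cVH cΛ) (symTablesAn1S2 3 Lc cΛt).M cE₂ cB Tc (symTablesAn1S2 3 Lc cΛt).vh₂S (symTablesAn1S2 3 Lc cΛt).mixFF l κ u κ' u') ((Lc : ℤ) • Y + toSite v)
        = comp (SpureCombOf (symTablesAn1S2 3 Lc cΛt) cE cVH cΛ l κ' u') (diagK (ξ • ∑ v ∈ box (3 + 1) Lc, legInd (toSite r) ((Lc : ℤ) • Y + toSite v))) - comp (diagK (ξ • ∑ v ∈ box (3 + 1) Lc, legInd (toSite r) ((Lc : ℤ) • Y + toSite v))) (SpureCombOf (symTablesAn1S2 3 Lc cΛt) cE cVH cΛ l κ' u') + R l Y κ' u')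
    (hTL'' : ∀ (l : ℕ) (Y : Fin (3 + 1) → ℤ) (κ : Fin (3 + 1)) (u : Fin (3 + 1) → ℤ),
      cH l • ∑ v ∈ box (3 + 1) Lc, divV (T2RecOf 3 Lc (GcombSh Lc) (SpureCombOf (symTablesAn1S2 3 Lc cΛt) cE cVH cΛ) (symTablesAn1S2 3 Lc cΛt).M cE₂ cB Tc (symTablesAn1S2 3 Lc cΛt).vh₂S (symTablesAn1S2 3 Lc cΛt).mixFF l κ u) ((Lc : ℤ) • Y + toSite v)
        = comp (SpureCombOf (symTablesAn1S2 3 Lc cΛt) cE cVH cΛ l κ u) (diagK (ξ • ∑ v ∈ box (3 + 1) Lc, legInd (toSite r) ((Lc : ℤ) • Y + toSite v))) - comp (diagK (ξ • ∑ v ∈ box (3 + 1) Lc, legInd (toSite r) ((Lc : ℤ) • Y + toSite v))) (SpureCombOf (symTablesAn1S2 3 Lc cΛt) cE cVH cΛ l κ u) + R'' l Y κ u)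
    (hC : ∀ (l : ℕ) (Y : Fin (3 + 1) → ℤ) (κ : Fin (3 + 1)) (u : Fin (3 + 1) → ℤ),
      trK (comp (SpureCombOf (symTablesAn1S2 3 Lc cΛt) cE cVH cΛ l κ u) (diagK (ξ • ∑ v ∈ box (3 + 1) Lc, legInd (toSite r) ((Lc : ℤ) • Y + toSite v))) - comp (diagK (ξ • ∑ v ∈ box (3 + 1) Lc, legInd (toSite r) ((Lc : ℤ) • Y + toSite v))) (SpureCombOf (symTablesAn1S2 3 Lc cΛt) cE cVH cΛ l κ u)) = sgnK (comp (SpureCombOf (symTablesAn1S2 3 Lc cΛt) cE cVH cΛ l κ u) (diagK (ξ • ∑ v ∈ box (3 + 1) Lc, legInd (toSite r) ((Lc : ℤ) • Y + toSite v))) - comp (diagK (ξ • ∑ v ∈ box (3 + 1) Lc, legInd (toSite r) ((Lc : ℤ) • Y + toSite v))) (SpureCombOf (symTablesAn1S2 3 Lc cΛt) cE cVH cΛ l κ u)))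
    (hR : ∀ (l : ℕ) (Y : Fin (3 + 1) → ℤ) (κ : Fin (3 + 1)) (u : Fin (3 + 1) → ℤ), trK (R l Y κ u) = -sgnK (R l Y κ u))
    (hR'' : ∀ (l : ℕ) (Y : Fin (3 + 1) → ℤ) (κ : Fin (3 + 1)) (u : Fin (3 + 1) → ℤ), trK (R'' l Y κ u) = -sgnK (R'' l Y κ u))
    {δ6 Cb cb θb : ℝ} (hδ6 : 0 < δ6) (hθb0 : 0 ≤ θb) (hθb1 : θb < 1)
    (Hb : ∀ n : ℕ, LocStencil₂ (fun κ u κ' u' => (cE₂ * (Lc : ℝ) ^ (2 * (3 + 1))) • mmRead Lc (K3OfK (unitK (sfStep Lc n) (smStep 3 Lc n) (GcombSh (d := 3) Lc n)) Lc (unitS (sfStep Lc n) (smStep 3 Lc n) (SpureCombOf (symTablesAn1S2 3 Lc cΛt) cE cVH cΛ n)) (unitM (sfStep Lc n) (smStep 3 Lc n) ((symTablesAn1S2 3 Lc cΛt).M n)) (W2SymOfK (unitK (sfStep Lc n) (smStep 3 Lc n) (GcombSh (d := 3) Lc n)) Lc (unitS (sfStep Lc n) (smStep 3 Lc n) (SpureCombOf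 (symTablesAn1S2 3 Lc cΛt) cE cVH cΛ n)) (unitM (sfStep Lc n) (smStep 3 Lc n) ((symTablesAn1S2 3 Lc cΛt).M n)) 0 (unitM₂ (sfStep Lc n) (smStep 3 Lc n) (M2Of 3 Lc (symTablesAn1S2 3 Lc cΛt).mixFF n))) κ u κ' u') + cB • (symTablesAn1S2 3 Lc cΛt).vh₂S κ u κ' u') Cb δ6)
    (Hbd : ∀ l : ℕ, LocStencil₂ ((fun κ u κ' u' => (cE₂ * (Lc : ℝ) ^ (2 * (3 + 1))) • mmRead Lc (K3OfK (unitK (sfStep Lc (l + 1)) (smStep 3 Lc (l + 1)) (GcombSh (d := 3) Lc (l + 1))) Lc (unitS (sfStep Lc (l + 1)) (smStep 3 Lc (l + 1)) (SpureCombOf (symTablesAn1S2 3 Lc cΛt) cE cVH cΛ (l + 1))) (unitM (sfStep Lc (l + 1)) (smStep 3 Lc (l + 1)) ((symTablesAn1S2 3 Lc cΛt).M (l + 1))) (W2SymOfK (unitK (sfStep Lc (l + 1)) (smStep 3 Lc (l + 1)) (GcombSh (d := 3) Lc (l + 1))) Lc (unitS (sfStep Lc (l + 1)) (smStep 3 Lc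 (l + 1)) (SpureCombOf (symTablesAn1S2 3 Lc cΛt) cE cVH cΛ (l + 1))) (unitM (sfStep Lc (l + 1)) (smStep 3 Lc (l + 1)) ((symTablesAn1S2 3 Lc cΛt).M (l + 1))) 0 (unitM₂ (sfStep Lc (l + 1)) (smStep 3 Lc (l + 1)) (M2Of 3 Lc (symTablesAn1S2 3 Lc cΛt).mixFF (l + 1)))) κ u κ' u') + cB • (symTablesAn1S2 3 Lc cΛt).vh₂S κ u κ' u')
      - (fun κ u κ' u' => (cE₂ * (Lc : ℝ) ^ (2 * (3 + 1))) • mmRead Lc (K3OfK (unitK (sfStep Lc l) (smStep 3 Lc l) (GcombSh (d := 3) Lc l)) Lc (unitS (sfStep Lc l) (smStep 3 Lc l) (SpureCombOf (symTablesAn1S2 3 Lc cΛt) cE cVH cΛ l)) (unitM (sfStep Lc l) (smStep 3 Lc l) ((symTablesAn1S2 3 Lc cΛt).M l)) (W2SymOfK (unitK (sfStep Lc l) (smStep 3 Lc l) (GcombSh (d := 3) Lc l)) Lc (unitS (sfStep Lc l) (smStep 3 Lc l) (SpureCombOf (symTablesAn1S2 3 Lc cΛt) cE cVH cΛ l)) (unitM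 (sfStep Lc l) (smStep 3 Lc l) ((symTablesAn1S2 3 Lc cΛt).M l)) 0 (unitM₂ (sfStep Lc l) (smStep 3 Lc l) (M2Of 3 Lc (symTablesAn1S2 3 Lc cΛt).mixFF l))) κ u κ' u') + cB • (symTablesAn1S2 3 Lc cΛt).vh₂S κ u κ' u')) (cb * θb ^ l) δ6)
    {Cs cS θS δS : ℝ}
    (hS : ∀ j, LocStencil (unitS (sfStep Lc j) (smStep 3 Lc j) (ScombOf (symTablesAn1S2 3 Lc cΛt) cE cVH cΛ j)) Cs δS)
    (hSall : ∀ k j, LocStencil (unitS (sfStep Lc (k + j)) (smStep 3 Lc (k + j)) (ScombOf (symTablesAn1S2 3 Lc cΛt) cE cVH cΛ (k + j)) -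
      unitS (sfStep Lc k) (smStep 3 Lc k) (ScombOf (symTablesAn1S2 3 Lc cΛt) cE cVH cΛ k)) (cS * θS ^ k) δS)
    (hδS : 0 < δS) (hθS0 : 0 ≤ θS) (hθS1 : θS < 1) :
    ∃ δ₃ σ₁ σ₂ σ₁d σ₂d ν₃ : ℝ, 0 < δ₃ ∧ 0 ≤ ν₃ ∧ ν₃ < 1 ∧
      (∀ n : ℕ, LocStencil₂ (fun (_ : Fin (3 + 1)) (p : Fin (3 + 1) → ℤ) (κ' : Fin (3 + 1)) (u' : Fin (3 + 1) → ℤ) =>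
      divV (fun κ₁ u₁ => (((1 : ℝ) / 2) • (unitS₂ (sfStep Lc n) (smStep 3 Lc n) (T2RecOf 3 Lc (GcombSh Lc) (SpureCombOf (symTablesAn1S2 3 Lc cΛt) cE cVH cΛ) (symTablesAn1S2 3 Lc cΛt).M cE₂ cB Tc (symTablesAn1S2 3 Lc cΛt).vh₂S (symTablesAn1S2 3 Lc cΛt).mixFF n) + (1 : ℝ) • fun κ u κ' u' => sgnK (trK ((unitS₂ (sfStep Lc n) (smStep 3 Lc n) (T2RecOf 3 Lc (GcombSh Lc) (SpureCombOf (symTablesAn1S2 3 Lc cΛt) cE cVH cΛ) (symTablesAn1S2 3 Lc cΛt).M cE₂ cB Tc (symTablesAn1S2 3 Lc cΛt).vh₂S (symTablesAn1S2 3 Lc cΛt).mixFF n)) κ u κ' u')))) κ₁ u₁ κ' u') p) σ₁ δ₃) ∧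
      (∀ n : ℕ, LocStencil₂ (fun (κ : Fin (3 + 1)) (u : Fin (3 + 1) → ℤ) (_ : Fin (3 + 1)) (p : Fin (3 + 1) → ℤ) =>
      divV (fun κ₁ u₁ => (((1 : ℝ) / 2) • (unitS₂ (sfStep Lc n) (smStep 3 Lc n) (T2RecOf 3 Lc (GcombSh Lc) (SpureCombOf (symTablesAn1S2 3 Lc cΛt) cE cVH cΛ) (symTablesAn1S2 3 Lc cΛt).M cE₂ cB Tc (symTablesAn1S2 3 Lc cΛt).vh₂S (symTablesAn1S2 3 Lc cΛt).mixFF n) + (1 : ℝ) • fun κ u κ' u' => sgnK (trK ((unitS₂ (sfStep Lc n) (smStep 3 Lc n) (T2RecOf 3 Lc (GcombSh Lc) (SpureCombOf (symTablesAn1S2 3 Lc cΛt) cE cVH cΛ) (symTablesAn1S2 3 Lc cΛt).M cE₂ cB Tc (symTablesAn1S2 3 Lc cΛt).vh₂S (symTablesAn1S2 3 Lc cΛt).mixFF n)) κ u κ' u')))) κ u κ₁ u₁) p) σ₂ δ₃) ∧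
      (∀ n : ℕ, LocStencil₂ (fun (_ : Fin (3 + 1)) (p : Fin (3 + 1) → ℤ) (κ' : Fin (3 + 1)) (u' : Fin (3 + 1) → ℤ) =>
      divV (fun κ₁ u₁ => ((((1 : ℝ) / 2) • (unitS₂ (sfStep Lc (n + 1)) (smStep 3 Lc (n + 1)) (T2RecOf 3 Lc (GcombSh Lc) (SpureCombOf (symTablesAn1S2 3 Lc cΛt) cE cVH cΛ) (symTablesAn1S2 3 Lc cΛt).M cE₂ cB Tc (symTablesAn1S2 3 Lc cΛt).vh₂S (symTablesAn1S2 3 Lc cΛt).mixFF (n + 1)) + (1 : ℝ) • fun κ u κ' u' => sgnK (trK ((unitS₂ (sfStep Lc (n + 1)) (smStep 3 Lc (n + 1)) (T2RecOf 3 Lc (GcombSh Lc) (SpureCombOf (symTablesAn1S2 3 Lc cΛt) cE cVH cΛ) (symTablesAn1S2 3 Lc cΛt).M cE₂ cB Tc (symTablesAn1S2 3 Lc cΛt).vh₂S (symTablesAn1S2 3 Lc cΛt).mixFF (n + 1))) κ u κ' u'))))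
        - (((1 : ℝ) / 2) • (unitS₂ (sfStep Lc n) (smStep 3 Lc n) (T2RecOf 3 Lc (GcombSh Lc) (SpureCombOf (symTablesAn1S2 3 Lc cΛt) cE cVH cΛ) (symTablesAn1S2 3 Lc cΛt).M cE₂ cB Tc (symTablesAn1S2 3 Lc cΛt).vh₂S (symTablesAn1S2 3 Lc cΛt).mixFF n) + (1 : ℝ) • fun κ u κ' u' => sgnK (trK ((unitS₂ (sfStep Lc n) (smStep 3 Lc n) (T2RecOf 3 Lc (GcombSh Lc) (SpureCombOf (symTablesAn1S2 3 Lc cΛt) cE cVH cΛ) (symTablesAn1S2 3 Lc cΛt).M cE₂ cB Tc (symTablesAn1S2 3 Lc cΛt).vh₂S (symTablesAn1S2 3 Lc cΛt).mixFF n)) κ u κ' u'))))) κ₁ u₁ κ' u') p) (σ₁d * ν₃ ^ n) δ₃) ∧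
      (∀ n : ℕ, LocStencil₂ (fun (κ : Fin (3 + 1)) (u : Fin (3 + 1) → ℤ) (_ : Fin (3 + 1)) (p : Fin (3 + 1) → ℤ) =>
      divV (fun κ₁ u₁ => ((((1 : ℝ) / 2) • (unitS₂ (sfStep Lc (n + 1)) (smStep 3 Lc (n + 1)) (T2RecOf 3 Lc (GcombSh Lc) (SpureCombOf (symTablesAn1S2 3 Lc cΛt) cE cVH cΛ) (symTablesAn1S2 3 Lc cΛt).M cE₂ cB Tc (symTablesAn1S2 3 Lc cΛt).vh₂S (symTablesAn1S2 3 Lc cΛt).mixFF (n + 1)) + (1 : ℝ) • fun κ u κ' u' => sgnK (trK ((unitS₂ (sfStep Lc (n + 1)) (smStep 3 Lc (n + 1)) (T2RecOf 3 Lc (GcombSh Lc) (SpureCombOf (symTablesAn1S2 3 Lc cΛt) cE cVH cΛ) (symTablesAn1S2 3 Lc cΛt).M cE₂ cB Tc (symTablesAn1S2 3 Lc cΛt).vh₂S (symTablesAn1S2 3 Lc cΛt).mixFF (n + 1))) κ u κ' u'))))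
        - (((1 : ℝ) / 2) • (unitS₂ (sfStep Lc n) (smStep 3 Lc n) (T2RecOf 3 Lc (GcombSh Lc) (SpureCombOf (symTablesAn1S2 3 Lc cΛt) cE cVH cΛ) (symTablesAn1S2 3 Lc cΛt).M cE₂ cB Tc (symTablesAn1S2 3 Lc cΛt).vh₂S (symTablesAn1S2 3 Lc cΛt).mixFF n) + (1 : ℝ) • fun κ u κ' u' => sgnK (trK ((unitS₂ (sfStep Lc n) (smStep 3 Lc n) (T2RecOf 3 Lc (GcombSh Lc) (SpureCombOf (symTablesAn1S2 3 Lc cΛt) cE cVH cΛ) (symTablesAn1S2 3 Lc cΛt).M cE₂ cB Tc (symTablesAn1S2 3 Lc cΛt).vh₂S (symTablesAn1S2 3 Lc cΛt).mixFF n)) κ u κ' u'))))) κ u κ₁ u₁) p) (σ₂d * ν₃ ^ n) δ₃) := by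
  obtain ⟨CE, δE, hδE, hE⟩ := exists_comb_evenRows_uniform_three hLc cΛt cE cVH cΛ ξ
    (cE₂ * (Lc : ℝ) ^ (2 * (3 + 1)) * ((Lc : ℝ) ^ (3 + 1))⁻¹ / 2) hr cH hcH hS hSall hδS hθS0 hθS1 R R''
  obtain ⟨CEd, θE, δE', hθE0, hθE1, hδE', hEd⟩ := exists_comb_evenRowsDrift_uniform_three hLc cΛt cE cVH cΛ ξ
    (cE₂ * (Lc : ℝ) ^ (2 * (3 + 1)) * ((Lc : ℝ) ^ (3 + 1))⁻¹ / 2) hr cH hcH hq hS hSall hδS hθS0 hθS1 R R''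
  exact exists_slavedDivRows_halfMember_comb_of_wardLetters (symTablesAn1S2 3 Lc cΛt) cE cVH cΛ cE₂ cB Tc (fun _ _ _ _ _ _ _ _ => rfl) (fun _ _ _ _ _ _ _ _ => rfl)
    hcH0 hTL hTL'' hC hR hR'' 1 (by norm_num) hδ6 hθb0 hθb1 Hb Hbd hδE hE hδE' hθE0 hθE1 hEd

/-! ## §2 The same with the source rows discharged — W4's `Hh`-rows at the record from the table laws, the S-slot rows and two scalar rows ONLY -/

/-- NOT IN PRINT; OUR BOOKKEEPING.  **W4's `Hh₁ Hh₂ Hh₁d Hh₂d` AT an1's RECORD (`ε = 1`) FROM THE TABLE LAWS + PARITIES, THE S-SLOT ROWS OF `ScombOf` AND `hcH ∕ hq` — `Hb ∕ Hbd` GONE**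
(MY `CombT2RecSourceRows.exists_sourceRows_comb_three_an1_of_scombOf_rows` feeds §1). -/
theorem exists_slavedDivRows_evenMember_comb_three_of_tableLaws_sRows (hLc : 2 ≤ Lc) (cΛt cE cVH cΛ cE₂ cB ξ : ℝ) (Tc : Fin 4 → Fin 4 → Fin 4 → Fin 4 → ℝ)
    {r : Fin (3 + 1) → ℕ} (hr : r ∈ box (3 + 1) Lc)
    {R R'' : ℕ → (Fin (3 + 1) → ℤ) → Fin (3 + 1) → (Fin (3 + 1) → ℤ) → MKer (3 + 1) (Fib 3)} {cH : ℕ → ℝ} (hcH0 : ∀ l, cH l ≠ 0)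
    {c₀ : ℝ} (hcH : ∀ l, |(sfStep Lc l * smStep 3 Lc l)⁻¹ * (cH l)⁻¹| ≤ c₀)
    (hq : ∀ l, (sfStep Lc (l + 1) * smStep 3 Lc (l + 1))⁻¹ * (cH (l + 1))⁻¹ = (sfStep Lc l * smStep 3 Lc l)⁻¹ * (cH l)⁻¹)
    (hTL : ∀ (l : ℕ) (Y : Fin (3 + 1) → ℤ) (κ' : Fin (3 + 1)) (u' : Fin (3 + 1) → ℤ),
      cH l • ∑ v ∈ box (3 + 1) Lc, divV (fun κ u => T2RecOf 3 Lc (GcombSh Lc) (SpureCombOf (symTablesAn1S2 3 Lc cΛt) cE cVH cΛ) (symTablesAn1S2 3 Lc cΛt).M cE₂ cB Tc (symTablesAn1S2 3 Lc cΛt).vh₂S (symTablesAn1S2 3 Lc cΛt).mixFF l κ u κ' u') ((Lc : ℤ) • Y + toSite v)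
        = comp (SpureCombOf (symTablesAn1S2 3 Lc cΛt) cE cVH cΛ l κ' u') (diagK (ξ • ∑ v ∈ box (3 + 1) Lc, legInd (toSite r) ((Lc : ℤ) • Y + toSite v))) - comp (diagK (ξ • ∑ v ∈ box (3 + 1) Lc, legInd (toSite r) ((Lc : ℤ) • Y + toSite v))) (SpureCombOf (symTablesAn1S2 3 Lc cΛt) cE cVH cΛ l κ' u') + R l Y κ' u')
    (hTL'' : ∀ (l : ℕ) (Y : Fin (3 + 1) → ℤ) (κ : Fin (3 + 1)) (u : Fin (3 + 1) → ℤ),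
      cH l • ∑ v ∈ box (3 + 1) Lc, divV (T2RecOf 3 Lc (GcombSh Lc) (SpureCombOf (symTablesAn1S2 3 Lc cΛt) cE cVH cΛ) (symTablesAn1S2 3 Lc cΛt).M cE₂ cB Tc (symTablesAn1S2 3 Lc cΛt).vh₂S (symTablesAn1S2 3 Lc cΛt).mixFF l κ u) ((Lc : ℤ) • Y + toSite v)
        = comp (SpureCombOf (symTablesAn1S2 3 Lc cΛt) cE cVH cΛ l κ u) (diagK (ξ • ∑ v ∈ box (3 + 1) Lc, legInd (toSite r) ((Lc : ℤ) • Y + toSite v))) - comp (diagK (ξ • ∑ v ∈ box (3 + 1) Lc, legInd (toSite r) ((Lc : ℤ) • Y + toSite v))) (SpureCombOf (symTablesAn1S2 3 Lc cΛt) cE cVH cΛ l κ u) + R'' l Y κ u)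
    (hC : ∀ (l : ℕ) (Y : Fin (3 + 1) → ℤ) (κ : Fin (3 + 1)) (u : Fin (3 + 1) → ℤ),
      trK (comp (SpureCombOf (symTablesAn1S2 3 Lc cΛt) cE cVH cΛ l κ u) (diagK (ξ • ∑ v ∈ box (3 + 1) Lc, legInd (toSite r) ((Lc : ℤ) • Y + toSite v))) - comp (diagK (ξ • ∑ v ∈ box (3 + 1) Lc, legInd (toSite r) ((Lc : ℤ) • Y + toSite v))) (SpureCombOf (symTablesAn1S2 3 Lc cΛt) cE cVH cΛ l κ u)) = sgnK (comp (SpureCombOf (symTablesAn1S2 3 Lc cΛt) cE cVH cΛ l κ u) (diagK (ξ • ∑ v ∈ box (3 + 1) Lc, legInd (toSite r) ((Lc : ℤ) • Y + toSite v))) - comp (diagK (ξ • ∑ v ∈ box (3 + 1) Lc, legInd (toSite r) ((Lc : ℤ) • Y + toSite v))) (SpureCombOf (symTablesAn1S2 3 Lc cΛt) cE cVH cΛ l κ u)))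
    (hR : ∀ (l : ℕ) (Y : Fin (3 + 1) → ℤ) (κ : Fin (3 + 1)) (u : Fin (3 + 1) → ℤ), trK (R l Y κ u) = -sgnK (R l Y κ u))
    (hR'' : ∀ (l : ℕ) (Y : Fin (3 + 1) → ℤ) (κ : Fin (3 + 1)) (u : Fin (3 + 1) → ℤ), trK (R'' l Y κ u) = -sgnK (R'' l Y κ u))
    {Cs cS θS δS : ℝ}
    (hS : ∀ j, LocStencil (unitS (sfStep Lc j) (smStep 3 Lc j) (ScombOf (symTablesAn1S2 3 Lc cΛt) cE cVH cΛ j)) Cs δS)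
    (hSall : ∀ k j, LocStencil (unitS (sfStep Lc (k + j)) (smStep 3 Lc (k + j)) (ScombOf (symTablesAn1S2 3 Lc cΛt) cE cVH cΛ (k + j)) -
      unitS (sfStep Lc k) (smStep 3 Lc k) (ScombOf (symTablesAn1S2 3 Lc cΛt) cE cVH cΛ k)) (cS * θS ^ k) δS)
    (hδS : 0 < δS) (hθS0 : 0 ≤ θS) (hθS1 : θS < 1) :
    ∃ δ₃ σ₁ σ₂ σ₁d σ₂d ν₃ : ℝ, 0 < δ₃ ∧ 0 ≤ ν₃ ∧ ν₃ < 1 ∧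
      (∀ n : ℕ, LocStencil₂ (fun (_ : Fin (3 + 1)) (p : Fin (3 + 1) → ℤ) (κ' : Fin (3 + 1)) (u' : Fin (3 + 1) → ℤ) =>
      divV (fun κ₁ u₁ => (((1 : ℝ) / 2) • (unitS₂ (sfStep Lc n) (smStep 3 Lc n) (T2RecOf 3 Lc (GcombSh Lc) (SpureCombOf (symTablesAn1S2 3 Lc cΛt) cE cVH cΛ) (symTablesAn1S2 3 Lc cΛt).M cE₂ cB Tc (symTablesAn1S2 3 Lc cΛt).vh₂S (symTablesAn1S2 3 Lc cΛt).mixFF n) + (1 : ℝ) • fun κ u κ' u' => sgnK (trK ((unitS₂ (sfStep Lc n) (smStep 3 Lc n) (T2RecOf 3 Lc (GcombSh Lc) (SpureCombOf (symTablesAn1S2 3 Lc cΛt) cE cVH cΛ) (symTablesAn1S2 3 Lc cΛt).M cE₂ cB Tc (symTablesAn1S2 3 Lc cΛt).vh₂S (symTablesAn1S2 3 Lc cΛt).mixFF n)) κ u κ' u')))) κ₁ u₁ κ' u') p) σ₁ δ₃) ∧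
      (∀ n : ℕ, LocStencil₂ (fun (κ : Fin (3 + 1)) (u : Fin (3 + 1) → ℤ) (_ : Fin (3 + 1)) (p : Fin (3 + 1) → ℤ) =>
      divV (fun κ₁ u₁ => (((1 : ℝ) / 2) • (unitS₂ (sfStep Lc n) (smStep 3 Lc n) (T2RecOf 3 Lc (GcombSh Lc) (SpureCombOf (symTablesAn1S2 3 Lc cΛt) cE cVH cΛ) (symTablesAn1S2 3 Lc cΛt).M cE₂ cB Tc (symTablesAn1S2 3 Lc cΛt).vh₂S (symTablesAn1S2 3 Lc cΛt).mixFF n) + (1 : ℝ) • fun κ u κ' u' => sgnK (trK ((unitS₂ (sfStep Lc n) (smStep 3 Lc n) (T2RecOf 3 Lc (GcombSh Lc) (SpureCombOf (symTablesAn1S2 3 Lc cΛt) cE cVH cΛ) (symTablesAn1S2 3 Lc cΛt).M cE₂ cB Tc (symTablesAn1S2 3 Lc cΛt).vh₂S (symTablesAn1S2 3 Lc cΛt).mixFF n)) κ u κ' u')))) κ u κ₁ u₁) p) σ₂ δ₃) ∧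
      (∀ n : ℕ, LocStencil₂ (fun (_ : Fin (3 + 1)) (p : Fin (3 + 1) → ℤ) (κ' : Fin (3 + 1)) (u' : Fin (3 + 1) → ℤ) =>
      divV (fun κ₁ u₁ => ((((1 : ℝ) / 2) • (unitS₂ (sfStep Lc (n + 1)) (smStep 3 Lc (n + 1)) (T2RecOf 3 Lc (GcombSh Lc) (SpureCombOf (symTablesAn1S2 3 Lc cΛt) cE cVH cΛ) (symTablesAn1S2 3 Lc cΛt).M cE₂ cB Tc (symTablesAn1S2 3 Lc cΛt).vh₂S (symTablesAn1S2 3 Lc cΛt).mixFF (n + 1)) + (1 : ℝ) • fun κ u κ' u' => sgnK (trK ((unitS₂ (sfStep Lc (n + 1)) (smStep 3 Lc (n + 1)) (T2RecOf 3 Lc (GcombSh Lc) (SpureCombOf (symTablesAn1S2 3 Lc cΛt) cE cVH cΛ) (symTablesAn1S2 3 Lc cΛt).M cE₂ cB Tc (symTablesAn1S2 3 Lc cΛt).vh₂S (symTablesAn1S2 3 Lc cΛt).mixFF (n + 1))) κ u κ' u'))))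
        - (((1 : ℝ) / 2) • (unitS₂ (sfStep Lc n) (smStep 3 Lc n) (T2RecOf 3 Lc (GcombSh Lc) (SpureCombOf (symTablesAn1S2 3 Lc cΛt) cE cVH cΛ) (symTablesAn1S2 3 Lc cΛt).M cE₂ cB Tc (symTablesAn1S2 3 Lc cΛt).vh₂S (symTablesAn1S2 3 Lc cΛt).mixFF n) + (1 : ℝ) • fun κ u κ' u' => sgnK (trK ((unitS₂ (sfStep Lc n) (smStep 3 Lc n) (T2RecOf 3 Lc (GcombSh Lc) (SpureCombOf (symTablesAn1S2 3 Lc cΛt) cE cVH cΛ) (symTablesAn1S2 3 Lc cΛt).M cE₂ cB Tc (symTablesAn1S2 3 Lc cΛt).vh₂S (symTablesAn1S2 3 Lc cΛt).mixFF n)) κ u κ' u'))))) κ₁ u₁ κ' u') p) (σ₁d * ν₃ ^ n) δ₃) ∧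
      (∀ n : ℕ, LocStencil₂ (fun (κ : Fin (3 + 1)) (u : Fin (3 + 1) → ℤ) (_ : Fin (3 + 1)) (p : Fin (3 + 1) → ℤ) =>
      divV (fun κ₁ u₁ => ((((1 : ℝ) / 2) • (unitS₂ (sfStep Lc (n + 1)) (smStep 3 Lc (n + 1)) (T2RecOf 3 Lc (GcombSh Lc) (SpureCombOf (symTablesAn1S2 3 Lc cΛt) cE cVH cΛ) (symTablesAn1S2 3 Lc cΛt).M cE₂ cB Tc (symTablesAn1S2 3 Lc cΛt).vh₂S (symTablesAn1S2 3 Lc cΛt).mixFF (n + 1)) + (1 : ℝ) • fun κ u κ' u' => sgnK (trK ((unitS₂ (sfStep Lc (n + 1)) (smStep 3 Lc (n + 1)) (T2RecOf 3 Lc (GcombSh Lc) (SpureCombOf (symTablesAn1S2 3 Lc cΛt) cE cVH cΛ) (symTablesAn1S2 3 Lc cΛt).M cE₂ cB Tc (symTablesAn1S2 3 Lc cΛt).vh₂S (symTablesAn1S2 3 Lc cΛt).mixFF (n + 1))) κ u κ' u'))))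
        - (((1 : ℝ) / 2) • (unitS₂ (sfStep Lc n) (smStep 3 Lc n) (T2RecOf 3 Lc (GcombSh Lc) (SpureCombOf (symTablesAn1S2 3 Lc cΛt) cE cVH cΛ) (symTablesAn1S2 3 Lc cΛt).M cE₂ cB Tc (symTablesAn1S2 3 Lc cΛt).vh₂S (symTablesAn1S2 3 Lc cΛt).mixFF n) + (1 : ℝ) • fun κ u κ' u' => sgnK (trK ((unitS₂ (sfStep Lc n) (smStep 3 Lc n) (T2RecOf 3 Lc (GcombSh Lc) (SpureCombOf (symTablesAn1S2 3 Lc cΛt) cE cVH cΛ) (symTablesAn1S2 3 Lc cΛt).M cE₂ cB Tc (symTablesAn1S2 3 Lc cΛt).vh₂S (symTablesAn1S2 3 Lc cΛt).mixFF n)) κ u κ' u'))))) κ u κ₁ u₁) p) (σ₂d * ν₃ ^ n) δ₃) := by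
  obtain ⟨Cb, δb, cb, θb, hδb, -, hθb0, hθb1, Hb, Hbd⟩ := exists_sourceRows_comb_three_an1_of_scombOf_rows hLc cΛt cE cVH cΛ cE₂ cB hS hSall hδS hθS0 hθS1
  exact exists_slavedDivRows_evenMember_comb_three_of_tableLaws hLc cΛt cE cVH cΛ cE₂ cB ξ Tc hr hcH0 hcH hq hTL hTL'' hC hR hR'' hδb hθb0 hθb1 Hb Hbd
    hS hSall hδS hθS0 hθS1

end Summit.QuantumFields.BalabanUV.Beta.GAN24.CombSlavedDivRowsAtRecord

end
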